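import Literature.InformationTheory.QuantumCodes.AbelianTwoBlockParameters
import Literature.InformationTheory.QuantumCodes.CSSParameters
import HarnessLib

/-!
# Toric codes on twisted tori (Kitaev's code on the square cellulation of `ℝ²/Λ`): definitions, check sums, `k = 2`

Topic `InformationTheory/QuantumCodes`; namespace `Literature.InformationTheory.QuantumCodes.TwistedToric`.
LADDER-QEC (venture cell `qec`), PARTITION row 08 («theorem for a FAMILY»), item 08.TWIST.

For a finite abelian group `G` and two elements `g₁ g₂ : G` the **twisted toric code** `code g₁ g₂` is the abelian
two-block (group-algebra) CSS code `LP[1 + x^{g₁}, 1 + x^{g₂}]` of the tree (`AbelianTwoBlock.css`, Lin–Pryadko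
2024 §IV): qubits `G ⊕ G` = the horizontal edges `j → j + g₁` (`inl j`) and the vertical edges `j → j + g₂`
(`inr j`) of the Cayley graph of `(G; g₁, g₂)`, `X`-checks = vertex stars, `Z`-checks = the square plaquettes
`j, j+g₁, j+g₂, j+g₁+g₂`. When `g₁, g₂` generate `G`, `G ≅ ℤ²/Λ` with the **period lattice**
`Λ = {m ∈ ℤ² : m₁•g₁ + m₂•g₂ = 0}` (`IsPeriod`), and the code is Kitaev's toric code on the torus `ℝ²/Λ` with
its (possibly twisted / rotated) square cellulation: `Λ = Lℤ²` is the `L × L` toric code of Dennis–Kitaev–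
Landahl–Preskill; `G` cyclic gives the generalized-bicycle «rotated toric codes» of Kovalev–Pryadko
[KovalevPryadko2013Hyperbicycle, Ex. 2: `[[2t²+2(t+1)², 2, 2t+1]]`], and Ex. 7 there (`[[2n²c, 2, nχ]]`, e.g.
`[[40,2,6]]`, `[[90,2,9]]`, `[[104,2,10]]`) as well as the checkerboard codes of [KovalevPryadko2012, §III.C] are
instances.

This file: the definitions (`binom`, `code`, `rel`, `IsPeriod`, `l1`, `systole`, the chain-level star sum `star`
and plaquette chain `face` for an ARBITRARY additive group — used upstairs on `ℤ²` and downstairs on `G` alike),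
the entry/check-sum formulas, and **`k = 2`** (`code_k_eq_two`, from the tree's `k = 2·dim(ker A ∩ ker B)`:
a function fixed by both translations is constant). The distance `d = sys₁(Λ) = min{|m₁|+|m₂| : m ∈ Λ∖0}`
(`systole`) is proved in the companion files `TwistedToricWalks`, `TwistedToricPlanar`, `TwistedToricHomology`,
`TwistedToricDistance`. Statements for every `G`; no instances, no notation, 0 named facts.

## References (locators read on the page)
* [KovalevPryadko2012] A. A. Kovalev, L. P. Pryadko, *Improved quantum hypergraph-product LDPC codes*, ISIT 2012
  = arXiv:1202.0928, §III.C (held text p0005 L43-63: periodicity vectors `L₁, L₂`, `n = |L₁ × L₂|`, `k = 2`;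
  L72-80: «it is easy to see … d(L₁,L₂) = min ‖m₁L₁+m₂L₂‖_∞» in checkerboard coordinates = the L¹ norm in the
  edge coordinates used here).
* [KovalevPryadko2013Hyperbicycle] A. A. Kovalev, L. P. Pryadko, PRA 88 (2013) 012311 = arXiv:1212.6703,
  §III.B Ex. 2 (held text p0008 L11-15) and §IV.G Ex. 7 (p0016 L18-24, «by construction … [[2n²c,2,nχ]]»).
* [DennisEtAl2002] E. Dennis, A. Kitaev, A. Landahl, J. Preskill, J. Math. Phys. 43 (2002) 4452, §3.1 (the
  untwisted case; tree `ToricCodeDistance.lean`).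
* [LinPryadko2024] H.-K. Lin, L. P. Pryadko, PRA 109 (2024) 022407 = arXiv:2306.16400, §IV (abelian 2BGA codes;
  tree `AbelianTwoBlockCodes.lean`, `AbelianTwoBlockParameters.lean`).
-/

namespace Literature.InformationTheory.QuantumCodes

open Matrix Finset

namespace TwistedToric

/-! ## `ℤ²` arithmetic (`𝔽₂` facts are Mathlib's `CharTwo.*`) -/

section Arith

/-- The **L¹ length** `|m₁| + |m₂|` of an integer vector. (definition)
[cite: KovalevPryadko2012, §III.C (p0005 L56: ‖L_i‖₁ ≡ |a_i| + |b_i|)] -/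
def l1 (m : ℤ × ℤ) : ℕ := m.1.natAbs + m.2.natAbs

/-- `l1 m = 0 ↔ m = 0`. [cite: KovalevPryadko2012, §III.C (p0005 L56: the norm ‖L‖₁ ≡ |a| + |b| of a lattice vector)] -/
theorem l1_eq_zero_iff (m : ℤ × ℤ) : l1 m = 0 ↔ m = 0 := by
  obtain ⟨a, b⟩ := m
  simp [l1, Prod.ext_iff]

/-- Triangle inequality for `l1`. [cite: KovalevPryadko2012, §III.C (p0005 L56: the norm ‖L‖₁ ≡ |a| + |b| of a lattice vector)] -/
theorem l1_add_le (m m' : ℤ × ℤ) : l1 (m + m') ≤ l1 m + l1 m' := by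
  simp only [l1, Prod.fst_add, Prod.snd_add]
  have h1 := Int.natAbs_add_le m.1 m'.1
  have h2 := Int.natAbs_add_le m.2 m'.2
  omega

/-- `l1 (m + m) = 2 · l1 m`. [cite: KovalevPryadko2012, §III.C (p0005 L56: the norm ‖L‖₁ ≡ |a| + |b| of a lattice vector)] -/
theorem l1_add_self (m : ℤ × ℤ) : l1 (m + m) = 2 * l1 m := by
  simp only [l1, Prod.fst_add, Prod.snd_add]
  rw [← two_mul, ← two_mul, Int.natAbs_mul, Int.natAbs_mul]
  simp; ring

/-- The number of qubits of a two-block code on `G` is `2|G|`. [cite: KovalevPryadko2012, §III.C (p0005 L58-60: n = |L₁ × L₂| vertices in the checkerboard picture, i.e. twice the number of torus vertices)] -/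
theorem card_qubits (G : Type*) [Fintype G] : Fintype.card (G ⊕ G) = 2 * Fintype.card G := by
  rw [Fintype.card_sum]; ring

end Arith

/-! ## Chain-level vocabulary for an arbitrary additive group (used on `G` and on `ℤ × ℤ` alike) -/

section Lattice

variable {V : Type*} [AddCommGroup V]

/-- The **star sum** of a `1`-chain `z` at the vertex `i`: the `𝔽₂`-sum of `z` over the (up to four) edges at
`i` — `inl i : i → i+g₁`, `inl (i−g₁) : i−g₁ → i`, `inr i`, `inr (i−g₂)`. For finite `V` this is the
`X`-syndrome bit `(H_X z)_i` (`code_HX_mulVec`). (definition)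
[cite: DennisEtAl2002, §3.1 (X_s = ⊗_{ℓ ∋ s} X_ℓ, the star operator)] -/
def star (g₁ g₂ : V) (z : V ⊕ V → ZMod 2) (i : V) : ZMod 2 :=
  z (.inl i) + z (.inl (i - g₁)) + z (.inr i) + z (.inr (i - g₂))

/-- The star sum is additive in the chain. [cite: DennisEtAl2002, §3.1 (star operators X_s; the syndrome is additive in the error chain)] -/
theorem star_add (g₁ g₂ : V) (z z' : V ⊕ V → ZMod 2) (i : V) :
    star g₁ g₂ (z + z') i = star g₁ g₂ z i + star g₁ g₂ z' i := by
  simp only [star, Pi.add_apply]; ring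

/-- The star sum of the zero chain vanishes. [cite: DennisEtAl2002, §3.1 (star operators X_s; the syndrome is additive in the error chain)] -/
theorem star_zero (g₁ g₂ : V) (i : V) : star g₁ g₂ 0 i = 0 := by
  simp [star]

/-- The **relation homomorphism** `ℤ² → V`, `m ↦ m₁•g₁ + m₂•g₂` (the covering map of the torus on vertices).
(definition) [cite: KovalevPryadko2012, §III.C (p0005 L53-56: identify all points connected by m₁L₁ + m₂L₂)] -/
def rel (g₁ g₂ : V) : ℤ × ℤ →+ V where
  toFun m := m.1 • g₁ + m.2 • g₂
  map_zero' := by simp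
  map_add' m m' := by
    simp only [Prod.fst_add, Prod.snd_add, add_zsmul]; abel

/-- `rel (m₁, m₂) = m₁•g₁ + m₂•g₂`. [cite: KovalevPryadko2012, §III.C (p0005 L53-56: lattice points are identified modulo m₁L₁ + m₂L₂ — the covering map ℤ² → torus)] -/
theorem rel_apply (g₁ g₂ : V) (m : ℤ × ℤ) : rel g₁ g₂ m = m.1 • g₁ + m.2 • g₂ := rfl

/-- `rel (1, 0) = g₁`. [cite: KovalevPryadko2012, §III.C (p0005 L53-56: lattice points are identified modulo m₁L₁ + m₂L₂ — the covering map ℤ² → torus)] -/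
theorem rel_e1 (g₁ g₂ : V) : rel g₁ g₂ (1, 0) = g₁ := by simp [rel_apply]

/-- `rel (0, 1) = g₂`. [cite: KovalevPryadko2012, §III.C (p0005 L53-56: lattice points are identified modulo m₁L₁ + m₂L₂ — the covering map ℤ² → torus)] -/
theorem rel_e2 (g₁ g₂ : V) : rel g₁ g₂ (0, 1) = g₂ := by simp [rel_apply]

/-- A **period** of `(V; g₁, g₂)`: an integer vector `m` with `m₁•g₁ + m₂•g₂ = 0` — the period lattice `Λ` of the
twisted torus `ℤ²/Λ ≅ ⟨g₁, g₂⟩`. (definition)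
[cite: KovalevPryadko2012, §III.C (p0005 L53-56: periodicity vectors L₁, L₂ and their combinations m₁L₁ + m₂L₂)] -/
def IsPeriod (g₁ g₂ : V) (m : ℤ × ℤ) : Prop := m.1 • g₁ + m.2 • g₂ = 0

/-- `m` is a period iff `rel m = 0`. [cite: KovalevPryadko2012, §III.C (p0005 L53-63: the periodicity vectors m₁L₁ + m₂L₂ form a lattice; equivalent periodicity vectors L'ᵢ = gᵢⱼLⱼ)] -/
theorem isPeriod_iff_rel (g₁ g₂ : V) (m : ℤ × ℤ) : IsPeriod g₁ g₂ m ↔ rel g₁ g₂ m = 0 := Iff.rfl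

/-- `0` is a period. [cite: KovalevPryadko2012, §III.C (p0005 L53-63: the periodicity vectors m₁L₁ + m₂L₂ form a lattice; equivalent periodicity vectors L'ᵢ = gᵢⱼLⱼ)] -/
theorem isPeriod_zero (g₁ g₂ : V) : IsPeriod g₁ g₂ 0 := by simp [IsPeriod]

/-- Periods are closed under addition. [cite: KovalevPryadko2012, §III.C (p0005 L53-63: the periodicity vectors m₁L₁ + m₂L₂ form a lattice; equivalent periodicity vectors L'ᵢ = gᵢⱼLⱼ)] -/
theorem IsPeriod.add {g₁ g₂ : V} {m m' : ℤ × ℤ} (h : IsPeriod g₁ g₂ m) (h' : IsPeriod g₁ g₂ m') :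
    IsPeriod g₁ g₂ (m + m') := by
  rw [isPeriod_iff_rel] at *; rw [map_add, h, h', add_zero]

/-- Periods are closed under negation. [cite: KovalevPryadko2012, §III.C (p0005 L53-63: the periodicity vectors m₁L₁ + m₂L₂ form a lattice; equivalent periodicity vectors L'ᵢ = gᵢⱼLⱼ)] -/
theorem IsPeriod.neg {g₁ g₂ : V} {m : ℤ × ℤ} (h : IsPeriod g₁ g₂ m) : IsPeriod g₁ g₂ (-m) := by
  rw [isPeriod_iff_rel] at *; rw [map_neg, h, neg_zero]

/-- Periods are closed under subtraction. [cite: KovalevPryadko2012, §III.C (p0005 L53-63: the periodicity vectors m₁L₁ + m₂L₂ form a lattice; equivalent periodicity vectors L'ᵢ = gᵢⱼLⱼ)] -/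
theorem IsPeriod.sub {g₁ g₂ : V} {m m' : ℤ × ℤ} (h : IsPeriod g₁ g₂ m) (h' : IsPeriod g₁ g₂ m') :
    IsPeriod g₁ g₂ (m - m') := by
  rw [sub_eq_add_neg]; exact h.add h'.neg

/-- Periods are closed under integer multiples. [cite: KovalevPryadko2012, §III.C (p0005 L53-63: the periodicity vectors m₁L₁ + m₂L₂ form a lattice; equivalent periodicity vectors L'ᵢ = gᵢⱼLⱼ)] -/
theorem IsPeriod.zsmul {g₁ g₂ : V} {m : ℤ × ℤ} (h : IsPeriod g₁ g₂ m) (t : ℤ) : IsPeriod g₁ g₂ (t • m) := by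
  rw [isPeriod_iff_rel] at *; rw [map_zsmul, h, smul_zero]

/-- Two lifts of the same vertex differ by a period. [cite: KovalevPryadko2012, §III.C (p0005 L53-56: lattice points are identified modulo m₁L₁ + m₂L₂ — the covering map ℤ² → torus)] -/
theorem isPeriod_sub_of_rel_eq {g₁ g₂ : V} {p p' : ℤ × ℤ} (h : rel g₁ g₂ p = rel g₁ g₂ p') :
    IsPeriod g₁ g₂ (p' - p) := by
  rw [isPeriod_iff_rel, map_sub, h, sub_self]

/-- The generation hypothesis `∀ x, ∃ m, m₁•g₁ + m₂•g₂ = x` from the subgroup-closure form `⟨g₁, g₂⟩ = V`.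
[cite: KovalevPryadko2012, §III.C (p0005 L53-56: lattice points are identified modulo m₁L₁ + m₂L₂ — the covering map ℤ² → torus)] -/
theorem gen_of_closure_eq_top {g₁ g₂ : V} (h : AddSubgroup.closure ({g₁, g₂} : Set V) = ⊤) (x : V) :
    ∃ m : ℤ × ℤ, m.1 • g₁ + m.2 • g₂ = x := by
  have hx : x ∈ AddSubgroup.closure ({g₁, g₂} : Set V) := by rw [h]; exact AddSubgroup.mem_top x
  obtain ⟨a, b, hab⟩ := AddSubgroup.mem_closure_pair.1 hx
  exact ⟨(a, b), hab⟩

/-- The **L¹ systole** of the period lattice: `sys₁(Λ) = min {|m₁| + |m₂| : m ∈ Λ, m ≠ 0}` — the length of a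
shortest closed geodesic of the twisted torus in the graph metric, and (files `TwistedToricHomology/Distance`)
the distance of the code; `0` by convention if there is no nonzero period (infinite `V`). (definition)
[cite: KovalevPryadko2012, §III.C eq. for d(L₁,L₂) (p0005 L77-80: d(L₁,L₂) = min_{m₁,m₂} ‖m₁L₁ + m₂L₂‖)] -/
noncomputable def systole (g₁ g₂ : V) : ℕ :=
  sInf {n | ∃ m : ℤ × ℤ, IsPeriod g₁ g₂ m ∧ m ≠ 0 ∧ l1 m = n}

/-- Every nonzero period is at least as long as the systole. [cite: KovalevPryadko2012, §III.C (p0005 L77-80: d(L₁,L₂) = min over (m₁,m₂) of ‖m₁L₁ + m₂L₂‖ — the shortest nonzero period)] -/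
theorem systole_le {g₁ g₂ : V} {m : ℤ × ℤ} (hm : IsPeriod g₁ g₂ m) (h0 : m ≠ 0) : systole g₁ g₂ ≤ l1 m :=
  Nat.sInf_le ⟨m, hm, h0, rfl⟩

/-- A shortest nonzero period is not twice a period (else its half would be a shorter nonzero period).
[cite: KovalevPryadko2012, §III.C (p0005 L77-80: d(L₁,L₂) = min over (m₁,m₂) of ‖m₁L₁ + m₂L₂‖ — the shortest nonzero period)] -/
theorem not_two_mul_of_systole {g₁ g₂ : V} {m μ : ℤ × ℤ} (hm0 : m ≠ 0) (hl : l1 m = systole g₁ g₂)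
    (hμ : IsPeriod g₁ g₂ μ) (h : m = μ + μ) : False := by
  have hμ0 : μ ≠ 0 := by rintro rfl; simp at h; exact hm0 h
  have h1 := systole_le hμ hμ0
  have h2 : l1 m = 2 * l1 μ := by rw [h, l1_add_self]
  have h3 : 0 < l1 μ := by rw [Nat.pos_iff_ne_zero, Ne, l1_eq_zero_iff]; exact hμ0
  omega

end Lattice

section Chains

variable {V : Type*} [AddCommGroup V] [DecidableEq V]

/-- The group-algebra element `1 + x^g ∈ 𝔽₂[V]` as a coefficient function (`= 0` when `g = 0`).
(definition) [cite: KovalevPryadko2013Hyperbicycle, §III.B Ex. 2 (p0008 L11-13: f₁(x) = 1 + x^{2t²+1})] -/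
def binom (g : V) : V → ZMod 2 := fun x => (if x = 0 then 1 else 0) + (if x = g then 1 else 0)

/-- `(1 + x^g)(i − j) = [j = i] + [j = i − g]`. [cite: KovalevPryadko2013Hyperbicycle, §III.B eq. (11) (p0007 L68-84: circulant blocks A, B generated by polynomials f₁, f₂)] -/
theorem binom_sub (g i j : V) :
    binom g (i - j) = (if j = i then 1 else 0) + (if j = i - g then 1 else 0) := by
  unfold binom
  have h1 : (i - j = 0) ↔ (j = i) := by rw [sub_eq_zero]; exact eq_comm
  have h2 : (i - j = g) ↔ (j = i - g) := by
    constructor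
    · intro h; rw [← h]; abel
    · intro h; rw [h]; abel
  simp only [h1, h2]

/-- `(1 + x^g)(j − i) = [j = i] + [j = i + g]`. [cite: KovalevPryadko2013Hyperbicycle, §III.B eq. (11) (p0007 L68-84: circulant blocks A, B generated by polynomials f₁, f₂)] -/
theorem binom_sub' (g i j : V) :
    binom g (j - i) = (if j = i then 1 else 0) + (if j = i + g then 1 else 0) := by
  unfold binom
  have h1 : (j - i = 0) ↔ (j = i) := by rw [sub_eq_zero]
  have h2 : (j - i = g) ↔ (j = i + g) := by
    rw [sub_eq_iff_eq_add, add_comm]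
  simp only [h1, h2]

/-- The indicator chain of the vertex `u` (a `0`-chain over `𝔽₂`). (definition) [folklore] -/
def vtx (u : V) : V → ZMod 2 := Pi.single u 1

/-- The **plaquette chain** of the face with lower-left corner `i`: its four boundary edges
`inl i` (bottom), `inl (i+g₂)` (top), `inr i` (left), `inr (i+g₁)` (right). For finite `V` this is the row
`i` of `H_Z` (`code_HZ_row`). (definition) [cite: DennisEtAl2002, §3.1 (Z_P = ⊗_{ℓ ∈ P} Z_ℓ, the plaquette operator)] -/
def face (g₁ g₂ : V) (i : V) : V ⊕ V → ZMod 2 :=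
  Pi.single (.inl i) 1 + Pi.single (.inl (i + g₂)) 1 + Pi.single (.inr i) 1 + Pi.single (.inr (i + g₁)) 1

/-- The star sum of a single edge `inl j` (`j → j + g₁`): `1` exactly at its two endpoints (as an `𝔽₂` sum;
`0` everywhere for a loop). [cite: DennisEtAl2002, §3.1 (a link's boundary is its two endpoint sites; star operators X_s detect it)] -/
theorem star_single_inl (g₁ g₂ : V) (j i : V) :
    star g₁ g₂ (Pi.single (Sum.inl j) 1) i = vtx j i + vtx (j + g₁) i := by
  simp only [star, vtx, Pi.single_apply, Sum.inl.injEq, reduceCtorEq, if_false, add_zero]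
  have h2 : (i - g₁ = j) ↔ (i = j + g₁) := by rw [sub_eq_iff_eq_add]
  simp only [h2]

/-- The star sum of a single edge `inr j` (`j → j + g₂`). [cite: DennisEtAl2002, §3.1 (a link's boundary is its two endpoint sites; star operators X_s detect it)] -/
theorem star_single_inr (g₁ g₂ : V) (j i : V) :
    star g₁ g₂ (Pi.single (Sum.inr j) 1) i = vtx j i + vtx (j + g₂) i := by
  simp only [star, vtx, Pi.single_apply, Sum.inr.injEq, reduceCtorEq, if_false, add_zero, zero_add]
  have h2 : (i - g₂ = j) ↔ (i = j + g₂) := by rw [sub_eq_iff_eq_add]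
  simp only [h2]

end Chains

/-! ## The code -/

section Code

variable {G : Type*} [AddCommGroup G] [DecidableEq G] [Fintype G]

/-- The **twisted toric code** of `(G; g₁, g₂)`: the abelian two-block CSS code `LP[1 + x^{g₁}, 1 + x^{g₂}]`,
`H_X = [A | B]`, `H_Z = [Bᵀ | Aᵀ]` with `A, B` the `G`-circulants of `1 + x^{g₁}`, `1 + x^{g₂}` — Kitaev's toric
code on the Cayley graph of `(G; g₁, g₂)` (qubits = edges `G ⊕ G`, stars, plaquettes). (definition)
[cite: KovalevPryadko2013Hyperbicycle, §III.B Ex. 2 (p0008 L11-15: the bicycle codes of f₁ = 1 + x^{2t²+1}, f₂ = x(1 + x^{2t²−1}) are «rotated toric codes»)] -/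
def code (g₁ g₂ : G) : CSSCode G G (G ⊕ G) := AbelianTwoBlock.css (binom g₁) (binom g₂)

/-- Entry formula: `H_X[i, inl j] = [j = i] + [j = i − g₁]` (vertex `i` meets the horizontal edges `i → i+g₁` and
`i−g₁ → i`). [cite: KovalevPryadko2013Hyperbicycle, §III.B eq. (11) (p0007 L68-76: G_X = (A,B), G_Z = (Bᵀ,Aᵀ) for commuting circulant A, B)] -/
theorem code_HX_inl (g₁ g₂ i j : G) :
    (code g₁ g₂).HX i (.inl j) = (if j = i then 1 else 0) + (if j = i - g₁ then 1 else 0) := by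
  simp [code, AbelianTwoBlock.css, AbelianTwoBlock.HX, circulant_apply, binom_sub]

/-- Entry formula: `H_X[i, inr j] = [j = i] + [j = i − g₂]`. [cite: KovalevPryadko2013Hyperbicycle, §III.B eq. (11) (p0007 L68-76: G_X = (A,B), G_Z = (Bᵀ,Aᵀ) for commuting circulant A, B)] -/
theorem code_HX_inr (g₁ g₂ i j : G) :
    (code g₁ g₂).HX i (.inr j) = (if j = i then 1 else 0) + (if j = i - g₂ then 1 else 0) := by
  simp [code, AbelianTwoBlock.css, AbelianTwoBlock.HX, circulant_apply, binom_sub]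

/-- Entry formula: `H_Z[i, inl j] = [j = i] + [j = i + g₂]` (the plaquette at `i` has bottom edge `inl i` and top
edge `inl (i + g₂)`). [cite: KovalevPryadko2013Hyperbicycle, §III.B eq. (11) (p0007 L68-76: G_X = (A,B), G_Z = (Bᵀ,Aᵀ) for commuting circulant A, B)] -/
theorem code_HZ_inl (g₁ g₂ i j : G) :
    (code g₁ g₂).HZ i (.inl j) = (if j = i then 1 else 0) + (if j = i + g₂ then 1 else 0) := by
  simp [code, AbelianTwoBlock.css, AbelianTwoBlock.HZ, circulant_apply, binom_sub']

/-- Entry formula: `H_Z[i, inr j] = [j = i] + [j = i + g₁]`. [cite: KovalevPryadko2013Hyperbicycle, §III.B eq. (11) (p0007 L68-76: G_X = (A,B), G_Z = (Bᵀ,Aᵀ) for commuting circulant A, B)] -/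
theorem code_HZ_inr (g₁ g₂ i j : G) :
    (code g₁ g₂).HZ i (.inr j) = (if j = i then 1 else 0) + (if j = i + g₁ then 1 else 0) := by
  simp [code, AbelianTwoBlock.css, AbelianTwoBlock.HZ, circulant_apply, binom_sub']

/-- **`H_X` is the star map**: `(H_X z)_i = z(inl i) + z(inl (i−g₁)) + z(inr i) + z(inr (i−g₂))`.
[cite: DennisEtAl2002, §3.1 (star operators X_s)] -/
theorem code_HX_mulVec (g₁ g₂ : G) (z : G ⊕ G → ZMod 2) :
    (code g₁ g₂).HX *ᵥ z = fun i => star g₁ g₂ z i := by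
  funext i
  simp only [mulVec, dotProduct, Fintype.sum_sum_type, code_HX_inl, code_HX_inr, add_mul, ite_mul, one_mul,
    zero_mul, Finset.sum_add_distrib, Finset.sum_ite_eq', Finset.mem_univ, if_true, star]
  ring

/-- **Row `i` of `H_Z` is the plaquette chain `face i`.** [cite: DennisEtAl2002, §3.1 (plaquette operators Z_P)] -/
theorem code_HZ_row (g₁ g₂ i : G) : (code g₁ g₂).HZ i = face g₁ g₂ i := by
  funext e
  cases e with
  | inl j =>
    simp only [code_HZ_inl, face, Pi.add_apply, Pi.single_apply, Sum.inl.injEq, reduceCtorEq, if_false,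
      add_zero]
  | inr j =>
    simp only [code_HZ_inr, face, Pi.add_apply, Pi.single_apply, Sum.inr.injEq, reduceCtorEq, if_false,
      zero_add, add_zero]

/-- `(H_Z c)_i = c(inl i) + c(inl (i+g₂)) + c(inr i) + c(inr (i+g₁))` — the flux of a cochain through the
plaquette at `i`. [cite: DennisEtAl2002, §3.1 (plaquette operators Z_P)] -/
theorem code_HZ_mulVec_apply (g₁ g₂ : G) (c : G ⊕ G → ZMod 2) (i : G) :
    ((code g₁ g₂).HZ *ᵥ c) i = c (.inl i) + c (.inl (i + g₂)) + c (.inr i) + c (.inr (i + g₁)) := by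
  simp only [mulVec, dotProduct, Fintype.sum_sum_type, code_HZ_inl, code_HZ_inr, add_mul, ite_mul, one_mul,
    zero_mul, Finset.sum_add_distrib, Finset.sum_ite_eq', Finset.mem_univ, if_true]
  ring

/-- Every plaquette chain is a `Z`-stabilizer: `face i ∈ rs H_Z`. [cite: DennisEtAl2002, §3.1 (plaquette operators Z_P generate the Z-stabilizers)] -/
theorem face_mem_rowSpZ (g₁ g₂ i : G) : face g₁ g₂ i ∈ (code g₁ g₂).rowSpZ := by
  refine mem_rowSpace_of_vecMul_eq (Pi.single i 1) ?_
  rw [← code_HZ_row]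
  funext e
  simp [vecMul, dotProduct, Pi.single_apply]

/-! ### `k = 2` -/

/-- A vector in `ker (circulant (1 + x^g))` is invariant under translation by `g` (step of `k = 2`). [cite: KovalevPryadko2012, §III.C (p0005 L60: «again, we have k=2»)] -/
theorem apply_eq_of_mem_ker {g : G} {u : G → ZMod 2}
    (hu : u ∈ LinearMap.ker (circulant (binom g)).mulVecLin) (i : G) : u (i + g) = u i := by
  rw [LinearMap.mem_ker, Matrix.mulVecLin_apply] at hu
  have h := congr_fun hu (i + g)
  simp only [mulVec, dotProduct, circulant_apply, binom_sub, add_mul, ite_mul, one_mul, zero_mul,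
    Finset.sum_add_distrib, Finset.sum_ite_eq', Finset.mem_univ, if_true, Pi.zero_apply, add_sub_cancel_right]
    at h
  exact CharTwo.add_eq_zero.1 h

/-- Constant functions lie in `ker (circulant (1 + x^g))` (step of `k = 2`). [cite: KovalevPryadko2012, §III.C (p0005 L60: «again, we have k=2»)] -/
theorem const_mem_ker (g : G) (a : ZMod 2) :
    (fun _ : G => a) ∈ LinearMap.ker (circulant (binom g)).mulVecLin := by
  rw [LinearMap.mem_ker, Matrix.mulVecLin_apply]
  funext i
  simp only [mulVec, dotProduct, circulant_apply, binom_sub, add_mul, ite_mul, one_mul, zero_mul,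
    Finset.sum_add_distrib, Finset.sum_ite_eq', Finset.mem_univ, if_true, Pi.zero_apply]
  exact CharTwo.add_self_eq_zero a

/-- **Generation ⇒ the common kernel is the line of constants**: if every `x : G` is `m₁•g₁ + m₂•g₂`, then
`ker A ∩ ker B = 𝔽₂ · 𝟙` for `A, B` the circulants of `1 + x^{g₁}`, `1 + x^{g₂}`.
[cite: KovalevPryadko2012, §III.C (p0005 L60: «again, we have k=2»)] -/
theorem ker_inf_ker_eq_span {g₁ g₂ : G} (hgen : ∀ x : G, ∃ m : ℤ × ℤ, m.1 • g₁ + m.2 • g₂ = x) :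
    LinearMap.ker (circulant (binom g₁)).mulVecLin ⊓ LinearMap.ker (circulant (binom g₂)).mulVecLin
      = Submodule.span (ZMod 2) {fun _ : G => (1 : ZMod 2)} := by
  refine le_antisymm ?_ ?_
  · intro u hu
    obtain ⟨h1, h2⟩ := Submodule.mem_inf.1 hu
    -- the translation stabilizer of `u` is a subgroup containing `g₁, g₂`, hence everything
    let S : AddSubgroup G :=
      { carrier := {t | ∀ i, u (i + t) = u i}
        zero_mem' := fun i => by rw [add_zero]
        add_mem' := fun {s t} hs ht i => by rw [← add_assoc, ht, hs]
        neg_mem' := fun {t} ht i => by rw [← ht (i + -t), neg_add_cancel_right] }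
    have hS1 : g₁ ∈ S := fun i => apply_eq_of_mem_ker h1 i
    have hS2 : g₂ ∈ S := fun i => apply_eq_of_mem_ker h2 i
    have hall : ∀ x : G, x ∈ S := by
      intro x
      obtain ⟨m, rfl⟩ := hgen x
      exact S.add_mem (S.zsmul_mem hS1 _) (S.zsmul_mem hS2 _)
    rw [Submodule.mem_span_singleton]
    refine ⟨u 0, ?_⟩
    funext x
    have hx := hall x 0
    rw [zero_add] at hx
    simp [hx]
  · rw [Submodule.span_le]
    rintro u hu
    rw [Set.mem_singleton_iff] at hu
    subst hu
    exact Submodule.mem_inf.2 ⟨const_mem_ker g₁ 1, const_mem_ker g₂ 1⟩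

/-- **`k = 2` for every twisted toric code with generating `g₁, g₂`** (two logical qubits: the torus has
`dim H₁(T²; 𝔽₂) = 2`). [cite: KovalevPryadko2012, §III.C (p0005 L60: «again, we have k=2 as for the standard checkerboard codes»)] -/
theorem code_k_eq_two {g₁ g₂ : G} (hgen : ∀ x : G, ∃ m : ℤ × ℤ, m.1 • g₁ + m.2 • g₂ = x) :
    (code g₁ g₂).k = 2 := by
  rw [code, AbelianTwoBlock.css_k_eq, ker_inf_ker_eq_span hgen, finrank_span_singleton]
  intro h
  have := congr_fun h 0
  simp at this

/-! ### The systole of the period lattice of a finite group -/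

omit [DecidableEq G] in
/-- `(|G|, 0)` is a period (the period lattice has finite index). [cite: KovalevPryadko2012, §III.C (p0005 L53-60: the identification lattice {m₁L₁ + m₂L₂} has finite index n = |L₁ × L₂|)] -/
theorem isPeriod_card (g₁ g₂ : G) : IsPeriod g₁ g₂ ((Fintype.card G : ℤ), 0) := by
  simp [IsPeriod, natCast_zsmul]

omit [DecidableEq G] in
/-- For a finite group the systole is attained by a nonzero period. [cite: KovalevPryadko2012, §III.C (p0005 L53-60: the identification lattice {m₁L₁ + m₂L₂} has finite index n = |L₁ × L₂|)] -/
theorem systole_spec (g₁ g₂ : G) :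
    ∃ m : ℤ × ℤ, IsPeriod g₁ g₂ m ∧ m ≠ 0 ∧ l1 m = systole g₁ g₂ := by
  have hne : ({n | ∃ m : ℤ × ℤ, IsPeriod g₁ g₂ m ∧ m ≠ 0 ∧ l1 m = n} : Set ℕ).Nonempty := by
    refine ⟨_, ((Fintype.card G : ℤ), 0), isPeriod_card g₁ g₂, ?_, rfl⟩
    simp [Prod.ext_iff, Fintype.card_ne_zero]
  exact Nat.sInf_mem hne

omit [DecidableEq G] in
/-- For a finite group the systole is positive. [cite: KovalevPryadko2012, §III.C (p0005 L53-60: the identification lattice {m₁L₁ + m₂L₂} has finite index n = |L₁ × L₂|)] -/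
theorem systole_pos (g₁ g₂ : G) : 0 < systole g₁ g₂ := by
  obtain ⟨m, -, h0, hl⟩ := systole_spec g₁ g₂
  rw [← hl, Nat.pos_iff_ne_zero, Ne, l1_eq_zero_iff]
  exact h0

end Code

end TwistedToric

end Literature.InformationTheory.QuantumCodes
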